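import Literature.MathematicalPhysics.KineticTheory.LanfordCollisionEstimates
import Literature.MathematicalPhysics.KineticTheory.LanfordClassBounds
import Mathlib.MeasureTheory.Integral.DominatedConvergence
import HarnessLib

/-!
# The positivity-preserving Picard map for the hard-sphere Boltzmann equation on the torus

(Topic MathematicalPhysics/KineticTheory; fourth layer of the proof of the named fact
`Literature.MathematicalPhysics.KineticTheory.ukai_lanford_bound` — local existence of mild
solutions in Lanford's class: Gallagher–Saint-Raymond–Texier 2013, Part I Ch. 2 §3.1 Thm 1
("fixed point argument in the space of continuous functions"), Part II Ch. 5 Thm 7 and §5.4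
(scale of weighted spaces `β(t) = β₀ - λ t`); Ukai 1974; Kaniel–Shinbrot 1978.)

For a continuous datum `f₀` on `T^d × ℝ^d` and a time horizon `T > 0` the (time-clamped)
Picard map of the mild hard-sphere Boltzmann equation, written at the foot of the backward
characteristic, is

  `Φ(u)(t, y, v) = f₀(y - t' v, v) + ∫₀^{t'} Q̃(u(τ, y - (t' - τ) v, ·))(v) dτ`, `t' = (t ∧ T) ∨ 0`,

where `Q̃(p)(v) = ∫∫ ((v - v_*)·ω)_+ (|p(v')| |p(v_*')| - p(v) |p(v_*)|) dω dv_*` is the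
sign-corrected collision operator (equal to `Q(p, p)` when `p ≥ 0`; its fixed points are
automatically nonnegative, see `LanfordExistence`). This file proves, for jointly continuous
`u` with a Gaussian bound:

* `continuous_absCollision_slice` — `(τ, y, v) ↦ Q̃(u(τ, y, ·))(v)` is jointly continuous
  (dominated convergence twice: `dω` on the finite sphere measure, then `dv_*` against
  `(1 + |v_*|) e^{-γ|v_*|²/2}`);
* `continuous_picard` — `Φ(u)` is jointly continuous (parametric interval integrals,
  `intervalIntegral.continuous_parametric_intervalIntegral_of_continuous`);
* `abs_picard_le` — the ball `|u(t, y, v)| ≤ R e^{-β(t)|v|²/2}`, `β(t) = β₀ - λ t'`,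
  `λ = β₀/(2T)`, is invariant as soon as `‖f₀‖_{β₀} + 4|S| J(β₀/2) R² ε(T) ≤ R`,
  `ε(T) = T + (2T/λ)^{1/2}` (GST 2013 (5.4.x): the decaying weight absorbs the loss
  `(1 + |v|)`, `weight_integral_clamp_le`);
* `abs_picard_sub_picard_le` — on that ball `Φ` is Lipschitz with constant
  `4|S| J(β₀/2) R ε(T)` in the weighted norms;
* `absCollision_nonneg_of_nonpos`, `absCollision_eq_collisionOpWith` — the two order
  properties of `Q̃` behind positivity.

No definitions are introduced: `Q̃` enters through a characterising hypothesis
`hQa : ∀ p v, Qa p v = ∫∫ …` on an arbitrary function `Qa`, discharged by `rfl` downstream.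

## References

* I. Gallagher, L. Saint-Raymond, B. Texier, *From Newton to Boltzmann: hard spheres and
  short-range potentials*, EMS (2013) = arXiv:1208.5753, Part I Ch. 2 §3.1, Part II Ch. 5.
* S. Ukai, Proc. Japan Acad. 50 (1974) 179–184.
* S. Kaniel, M. Shinbrot, *The Boltzmann equation. I. Uniqueness and local existence*,
  Comm. Math. Phys. 58 (1978) 65–84.
-/

open MeasureTheory Metric Real Set Filter Topology
open scoped InnerProductSpace ENNReal
open Literature.Analysis.FluidPDE

namespace Literature.MathematicalPhysics.KineticTheory

noncomputable section

section Picard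

variable {d : Type*} [Fintype d]

/-! ## The sign-corrected collision integrand -/

/-- Pointwise bound on the sign-corrected hard-sphere collision integrand under a Gaussian bound
`|p| ≤ R e^{-γ|w|²/2}`:
`|((v-v_*)·ω)_+ (|p'| |p_*'| - p |p_*|)| ≤ 2 R² ψ_γ(v) ψ_γ(v_*)`, `ψ_γ(u) = (1 + |u|) e^{-γ|u|²/2}`
(conservation of energy; `Literature.Analysis.FluidPDE.abs_gain_le_and_abs_loss_le`). [folklore] -/
theorem abs_absCollisionIntegrand_le {p : EuclideanSpace ℝ d → ℝ} {R γ : ℝ}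
    (hp : ∀ w, |p w| ≤ R * exp (-(γ / 2) * ‖w‖ ^ 2)) (v w : EuclideanSpace ℝ d)
    (ω : sphere (0 : EuclideanSpace ℝ d) 1) :
    |hardSphereKernel (v, w) ω *
        (|p (collide ω (v, w)).1| * |p (collide ω (v, w)).2| - p v * |p w|)| ≤
      2 * R ^ 2 * (((1 + ‖v‖) * exp (-(γ / 2) * ‖v‖ ^ 2)) *
        ((1 + ‖w‖) * exp (-(γ / 2) * ‖w‖ ^ 2))) := by
  have hg : ∀ u, |(fun u => |p u|) u| ≤ R * exp (-(γ / 2) * ‖u‖ ^ 2) := fun u => by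
    simp only [abs_abs]; exact hp u
  obtain ⟨h1, h2⟩ := abs_gain_le_and_abs_loss_le
    (isGradCutoffKernel_hardSphereKernel (E := EuclideanSpace ℝ d)) zero_le_one
    hardSphereKernel_le_one_mul hg (v, w) ω
  have h1' : |hardSphereKernel (v, w) ω * (|p (collide ω (v, w)).1| * |p (collide ω (v, w)).2|)| ≤
      1 * R ^ 2 * (((1 + ‖v‖) * exp (-(γ / 2) * ‖v‖ ^ 2)) *
        ((1 + ‖w‖) * exp (-(γ / 2) * ‖w‖ ^ 2))) := by
    simpa only using h1
  have h2' : |hardSphereKernel (v, w) ω * (|p v| * |p w|)| ≤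
      1 * R ^ 2 * (((1 + ‖v‖) * exp (-(γ / 2) * ‖v‖ ^ 2)) *
        ((1 + ‖w‖) * exp (-(γ / 2) * ‖w‖ ^ 2))) := by
    simpa only using h2
  have h3 : |hardSphereKernel (v, w) ω * (p v * |p w|)| =
      |hardSphereKernel (v, w) ω * (|p v| * |p w|)| := by
    simp only [abs_mul, abs_abs]
  rw [mul_sub]
  refine (abs_sub _ _).trans ?_
  rw [h3]
  linarith

/-- The sign-corrected collision operator is nonnegative at a velocity where the density is
nonpositive: its integrand `((v-v_*)·ω)_+ (|p'| |p_*'| - p(v) |p_*|)` is then pointwise `≥ 0`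
(no integrability needed). This is the order property behind the positivity of the Picard fixed
point (Kaniel–Shinbrot 1978 §2). [folklore] -/
theorem absCollision_nonneg_of_nonpos
    {Qa : (EuclideanSpace ℝ d → ℝ) → EuclideanSpace ℝ d → ℝ}
    (hQa : ∀ p v, Qa p v = ∫ w, ∫ ω, hardSphereKernel (v, w) ω *
      (|p (collide ω (v, w)).1| * |p (collide ω (v, w)).2| - p v * |p w|) ∂sphereMeasure)
    {p : EuclideanSpace ℝ d → ℝ} {v : EuclideanSpace ℝ d} (hpv : p v ≤ 0) : 0 ≤ Qa p v := by
  rw [hQa]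
  refine integral_nonneg fun w => integral_nonneg fun ω => ?_
  have hB : 0 ≤ hardSphereKernel (v, w) ω := le_max_right _ _
  have h1 : 0 ≤ |p (collide ω (v, w)).1| * |p (collide ω (v, w)).2| := by positivity
  have h2 : p v * |p w| ≤ 0 := mul_nonpos_iff.2 (Or.inr ⟨hpv, abs_nonneg _⟩)
  exact mul_nonneg hB (by linarith)

/-- On nonnegative densities the sign-corrected collision operator is the collision operator
`Q(p, p)` (the integrands coincide pointwise). [folklore] -/
theorem absCollision_eq_collisionOpWith
    {Qa : (EuclideanSpace ℝ d → ℝ) → EuclideanSpace ℝ d → ℝ}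
    (hQa : ∀ p v, Qa p v = ∫ w, ∫ ω, hardSphereKernel (v, w) ω *
      (|p (collide ω (v, w)).1| * |p (collide ω (v, w)).2| - p v * |p w|) ∂sphereMeasure)
    {p : EuclideanSpace ℝ d → ℝ} (hp : ∀ w, 0 ≤ p w) (v : EuclideanSpace ℝ d) :
    Qa p v = collisionOpWith hardSphereKernel p p v := by
  rw [hQa]
  simp only [collisionOpWith, abs_of_nonneg (hp _)]

/-! ## Joint continuity of the collision term and of the Picard map -/

/-- **Joint continuity of the sign-corrected collision term.** If `u(t, y, v)` is jointly
continuous with `|u| ≤ R e^{-γ|v|²/2}`, `γ > 0`, then `(t, y, v) ↦ Q̃(u(t, y, ·))(v)` is jointly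
continuous (dominated convergence in `ω` on the finite sphere measure, then in `v_*` against
`(1 + |v_*|) e^{-γ|v_*|²/2}`; GST 2013 Part I Ch. 2 §3.1: the fixed point is sought "in the space
of continuous functions"). [cite: GST2013, Part I Ch. 2 §3.1] -/
theorem continuous_absCollision_slice
    {Qa : (EuclideanSpace ℝ d → ℝ) → EuclideanSpace ℝ d → ℝ}
    (hQa : ∀ p v, Qa p v = ∫ w, ∫ ω, hardSphereKernel (v, w) ω *
      (|p (collide ω (v, w)).1| * |p (collide ω (v, w)).2| - p v * |p w|) ∂sphereMeasure)
    {u : ℝ → UnitAddTorus d → EuclideanSpace ℝ d → ℝ}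
    (hu : Continuous fun z : ℝ × UnitAddTorus d × EuclideanSpace ℝ d => u z.1 z.2.1 z.2.2)
    {R γ : ℝ} (hγ : 0 < γ) (hub : ∀ t y v, |u t y v| ≤ R * exp (-(γ / 2) * ‖v‖ ^ 2)) :
    Continuous fun z : ℝ × UnitAddTorus d × EuclideanSpace ℝ d => Qa (u z.1 z.2.1) z.2.2 := by
  haveI := isFiniteMeasure_sphereMeasure (E := EuclideanSpace ℝ d)
  -- the integrand, on `((t, y, v), w)` and `ω`
  set I : (ℝ × UnitAddTorus d × EuclideanSpace ℝ d) × EuclideanSpace ℝ d →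
      sphere (0 : EuclideanSpace ℝ d) 1 → ℝ := fun q ω =>
    hardSphereKernel (q.1.2.2, q.2) ω *
      (|u q.1.1 q.1.2.1 (collide ω (q.1.2.2, q.2)).1| * |u q.1.1 q.1.2.1 (collide ω (q.1.2.2, q.2)).2| -
        u q.1.1 q.1.2.1 q.1.2.2 * |u q.1.1 q.1.2.1 q.2|) with hI
  set ψ : EuclideanSpace ℝ d → ℝ := fun x => (1 + ‖x‖) * exp (-(γ / 2) * ‖x‖ ^ 2) with hψ
  have hψ0 : ∀ x, 0 ≤ ψ x := fun x => by positivity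
  have hψle : ∀ x, ψ x ≤ 1 + ‖x‖ := fun x => by
    simp only [hψ]
    refine mul_le_of_le_one_right (by positivity) (exp_le_one_iff.2 ?_)
    nlinarith [sq_nonneg ‖x‖, hγ.le]
  -- pointwise bound
  have hIb : ∀ q ω, |I q ω| ≤ 2 * R ^ 2 * (ψ q.1.2.2 * ψ q.2) := fun q ω =>
    abs_absCollisionIntegrand_le (p := u q.1.1 q.1.2.1) (fun w => hub _ _ w) q.1.2.2 q.2 ω
  -- joint continuity of the integrand
  have hIc : Continuous fun s : ((ℝ × UnitAddTorus d × EuclideanSpace ℝ d) × EuclideanSpace ℝ d) ×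
      sphere (0 : EuclideanSpace ℝ d) 1 => I s.1 s.2 := by
    have hU : ∀ {g₁ : ((ℝ × UnitAddTorus d × EuclideanSpace ℝ d) × EuclideanSpace ℝ d) ×
          sphere (0 : EuclideanSpace ℝ d) 1 → ℝ}
        {g₂ : ((ℝ × UnitAddTorus d × EuclideanSpace ℝ d) × EuclideanSpace ℝ d) ×
          sphere (0 : EuclideanSpace ℝ d) 1 → UnitAddTorus d}
        {g₃ : ((ℝ × UnitAddTorus d × EuclideanSpace ℝ d) × EuclideanSpace ℝ d) ×
          sphere (0 : EuclideanSpace ℝ d) 1 → EuclideanSpace ℝ d},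
        Continuous g₁ → Continuous g₂ → Continuous g₃ →
          Continuous fun s => u (g₁ s) (g₂ s) (g₃ s) :=
      fun h1 h2 h3 => hu.comp (h1.prodMk (h2.prodMk h3))
    have hB : Continuous fun s : ((ℝ × UnitAddTorus d × EuclideanSpace ℝ d) ×
        EuclideanSpace ℝ d) × sphere (0 : EuclideanSpace ℝ d) 1 =>
        hardSphereKernel (s.1.1.2.2, s.1.2) s.2 := by
      unfold hardSphereKernel
      fun_prop
    have hcol : Continuous fun s : ((ℝ × UnitAddTorus d × EuclideanSpace ℝ d) ×
        EuclideanSpace ℝ d) × sphere (0 : EuclideanSpace ℝ d) 1 =>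
        collide s.2 (s.1.1.2.2, s.1.2) :=
      continuous_collide_uncurry.comp
        ((continuous_fst.snd.snd.prodMk continuous_snd).fst'.prodMk continuous_snd :
          Continuous fun s : ((ℝ × UnitAddTorus d × EuclideanSpace ℝ d) ×
            EuclideanSpace ℝ d) × sphere (0 : EuclideanSpace ℝ d) 1 => ((s.1.1.2.2, s.1.2), s.2))
    simp only [hI]
    exact hB.mul (((hU (by fun_prop) (by fun_prop) hcol.fst).abs.mul
      (hU (by fun_prop) (by fun_prop) hcol.snd).abs).sub
      ((hU (by fun_prop) (by fun_prop) (by fun_prop)).mul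
        (hU (by fun_prop) (by fun_prop) (by fun_prop)).abs))
  -- Step A: the `dω` integral is jointly continuous in `((t, y, v), w)`
  have hg : Continuous fun q : (ℝ × UnitAddTorus d × EuclideanSpace ℝ d) × EuclideanSpace ℝ d =>
      ∫ ω, I q ω ∂sphereMeasure := by
    refine continuous_iff_continuousAt.2 fun q₀ => ?_
    set C : ℝ := 2 * R ^ 2 * ((2 + ‖q₀.1.2.2‖) * (2 + ‖q₀.2‖)) with hC
    have hUq : {q : (ℝ × UnitAddTorus d × EuclideanSpace ℝ d) × EuclideanSpace ℝ d |
        ‖q.1.2.2‖ < ‖q₀.1.2.2‖ + 1 ∧ ‖q.2‖ < ‖q₀.2‖ + 1} ∈ 𝓝 q₀ := by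
      refine IsOpen.mem_nhds ?_ ?_
      · exact (isOpen_lt continuous_fst.snd.snd.norm continuous_const).inter
          (isOpen_lt continuous_snd.norm continuous_const)
      · show ‖q₀.1.2.2‖ < ‖q₀.1.2.2‖ + 1 ∧ ‖q₀.2‖ < ‖q₀.2‖ + 1
        exact ⟨lt_add_one _, lt_add_one _⟩
    refine continuousAt_of_dominated (bound := fun _ => C) ?_ ?_ (integrable_const C) ?_
    · exact Eventually.of_forall fun q =>
        (hIc.comp (continuous_const.prodMk continuous_id)).aestronglyMeasurable
    · filter_upwards [hUq] with q hq
      refine Eventually.of_forall fun ω => ?_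
      rw [Real.norm_eq_abs]
      refine (hIb q ω).trans ?_
      have e1 : ψ q.1.2.2 ≤ 2 + ‖q₀.1.2.2‖ := (hψle _).trans (by linarith [hq.1])
      have e2 : ψ q.2 ≤ 2 + ‖q₀.2‖ := (hψle _).trans (by linarith [hq.2])
      have := hψ0 q.1.2.2
      have := hψ0 q.2
      simp only [hC]
      gcongr
    · exact Eventually.of_forall fun ω =>
        (hIc.comp (continuous_id.prodMk continuous_const)).continuousAt
  -- Step B: the `dw` integral is continuous in `(t, y, v)`
  have hF : Continuous fun z : ℝ × UnitAddTorus d × EuclideanSpace ℝ d =>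
      ∫ w, (∫ ω, I (z, w) ω ∂sphereMeasure) := by
    refine continuous_iff_continuousAt.2 fun z₀ => ?_
    set S : ℝ := (sphereMeasure : Measure (sphere (0 : EuclideanSpace ℝ d) 1)).real univ with hS
    set bound : EuclideanSpace ℝ d → ℝ := fun w => S * (2 * R ^ 2 * (2 + ‖z₀.2.2‖)) * ψ w
      with hbound
    have hUz : {z : ℝ × UnitAddTorus d × EuclideanSpace ℝ d | ‖z.2.2‖ < ‖z₀.2.2‖ + 1} ∈ 𝓝 z₀ :=
      IsOpen.mem_nhds (isOpen_lt continuous_snd.snd.norm continuous_const)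
        (show ‖z₀.2.2‖ < ‖z₀.2.2‖ + 1 from lt_add_one _)
    refine continuousAt_of_dominated (bound := bound) ?_ ?_ ?_ ?_
    · exact Eventually.of_forall fun z =>
        (hg.comp (continuous_const.prodMk continuous_id)).aestronglyMeasurable
    · filter_upwards [hUz] with z hz
      refine Eventually.of_forall fun w => ?_
      have e1 : ψ z.2.2 ≤ 2 + ‖z₀.2.2‖ := (hψle _).trans (by linarith [hz])
      calc ‖∫ ω, I (z, w) ω ∂sphereMeasure‖ ≤ ∫ ω, ‖I (z, w) ω‖ ∂sphereMeasure :=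
            norm_integral_le_integral_norm _
        _ ≤ ∫ _ω, 2 * R ^ 2 * (ψ z.2.2 * ψ w) ∂sphereMeasure :=
            integral_mono_of_nonneg (Eventually.of_forall fun _ => norm_nonneg _)
              (integrable_const _)
              (Eventually.of_forall fun ω => by dsimp only; rw [Real.norm_eq_abs]; exact hIb (z, w) ω)
        _ = S * (2 * R ^ 2 * (ψ z.2.2 * ψ w)) := by rw [integral_const, smul_eq_mul, hS]
        _ ≤ S * (2 * R ^ 2 * ((2 + ‖z₀.2.2‖) * ψ w)) := by
            have := hψ0 w
            have : (0 : ℝ) ≤ S := measureReal_nonneg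
            gcongr
        _ = bound w := by simp only [hbound]; ring
    · exact (integrable_one_add_norm_mul_exp hγ).const_mul _
    · exact Eventually.of_forall fun w =>
        (hg.comp (continuous_id.prodMk continuous_const)).continuousAt
  have hQF : (fun z : ℝ × UnitAddTorus d × EuclideanSpace ℝ d => Qa (u z.1 z.2.1) z.2.2) =
      fun z => ∫ w, (∫ ω, I (z, w) ω ∂sphereMeasure) := by
    funext z
    rw [hQa]
  rw [hQF]
  exact hF

/-- **Joint continuity of the Picard map.** For jointly continuous `u` with a Gaussian bound and
a continuous datum `f₀`, the time-clamped Picard map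
`Φ(u)(t, y, v) = f₀(y - t'v, v) + ∫₀^{t'} Q̃(u(τ, y - (t'-τ)v, ·))(v) dτ`, `t' = (t ∧ T) ∨ 0`, is
jointly continuous on `ℝ × T^d × ℝ^d` (parametric interval integral of a continuous
integrand). [folklore] -/
theorem continuous_picard
    {Qa : (EuclideanSpace ℝ d → ℝ) → EuclideanSpace ℝ d → ℝ}
    (hQa : ∀ p v, Qa p v = ∫ w, ∫ ω, hardSphereKernel (v, w) ω *
      (|p (collide ω (v, w)).1| * |p (collide ω (v, w)).2| - p v * |p w|) ∂sphereMeasure)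
    {u : ℝ → UnitAddTorus d → EuclideanSpace ℝ d → ℝ}
    (hu : Continuous fun z : ℝ × UnitAddTorus d × EuclideanSpace ℝ d => u z.1 z.2.1 z.2.2)
    {R γ : ℝ} (hγ : 0 < γ) (hub : ∀ t y v, |u t y v| ≤ R * exp (-(γ / 2) * ‖v‖ ^ 2))
    {f₀ : UnitAddTorus d → EuclideanSpace ℝ d → ℝ} (hf₀ : Continuous (Function.uncurry f₀))
    (T : ℝ) :
    Continuous fun z : ℝ × UnitAddTorus d × EuclideanSpace ℝ d =>
      f₀ (z.2.1 - Literature.Analysis.FunctionSpaces.Torus.proj (max 0 (min T z.1) • z.2.2)) z.2.2 +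
        ∫ τ in (0 : ℝ)..max 0 (min T z.1),
          Qa (u τ (z.2.1 - Literature.Analysis.FunctionSpaces.Torus.proj
            ((max 0 (min T z.1) - τ) • z.2.2))) z.2.2 := by
  have hF := continuous_absCollision_slice hQa hu hγ hub
  have hc : Continuous fun t : ℝ => max 0 (min T t) := by fun_prop
  have hπ := Literature.Analysis.FunctionSpaces.Torus.continuous_proj (d := d)
  refine Continuous.add ?_ ?_
  · exact hf₀.comp (by fun_prop : Continuous fun z : ℝ × UnitAddTorus d × EuclideanSpace ℝ d =>
      (z.2.1 - Literature.Analysis.FunctionSpaces.Torus.proj (max 0 (min T z.1) • z.2.2), z.2.2))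
  · refine intervalIntegral.continuous_parametric_intervalIntegral_of_continuous
      (f := fun (z : ℝ × UnitAddTorus d × EuclideanSpace ℝ d) (τ : ℝ) =>
        Qa (u τ (z.2.1 - Literature.Analysis.FunctionSpaces.Torus.proj
          ((max 0 (min T z.1) - τ) • z.2.2))) z.2.2) ?_ (hc.comp continuous_fst)
    exact hF.comp (by fun_prop : Continuous fun q : (ℝ × UnitAddTorus d × EuclideanSpace ℝ d) × ℝ =>
      (q.2, q.1.2.1 - Literature.Analysis.FunctionSpaces.Torus.proj
        ((max 0 (min T q.1.1) - q.2) • q.1.2.2), q.1.2.2))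

/-! ## Ball invariance and contraction in the scale of Gaussian weights -/

/-- The weight integral along a clamped time: for `λ > 0`, `t' ∈ [0, T]` and any real `r`,
`∫₀^{t'} (1 + r) e^{-(β₀ - λτ) r²/2} dτ ≤ (T + (2T/λ)^{1/2}) e^{-(β₀ - λ t') r²/2}`
(`intervalIntegral_weight_le` at `t₁ = 0`, and monotonicity in `t' ≤ T`). [folklore] -/
theorem weight_integral_clamp_le {β₀ lam T t' : ℝ} (hlam : 0 < lam) (ht' : t' ∈ Icc 0 T)
    (r : ℝ) :
    ∫ τ in (0 : ℝ)..t', (1 + r) * exp (-((β₀ - lam * τ) / 2) * r ^ 2) ≤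
      (T + Real.sqrt (2 * T / lam)) * exp (-((β₀ - lam * t') / 2) * r ^ 2) := by
  have h := intervalIntegral_weight_le hlam β₀ 0 t' ht'.1 r
  simp only [sub_zero] at h
  refine h.trans (mul_le_mul_of_nonneg_right (add_le_add ht'.2 (Real.sqrt_le_sqrt ?_))
    (exp_pos _).le)
  exact div_le_div_of_nonneg_right (by linarith [ht'.2]) hlam.le

/-- **Invariance of the weighted ball under the Picard map** (the a priori bound of GST 2013
Part II Ch. 5, proof of Thm 6–7 / Part I Ch. 2 §3.1 Thm 1, for the equation instead of the
hierarchy). Let `T > 0`, `λ = β₀/(2T)`, `β(t) = β₀ - λ t'`, `t' = (t ∧ T) ∨ 0`; let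
`|f₀| ≤ K_f e^{-β₀|v|²/2}` and let `u` be jointly continuous with `|u(t)| ≤ R e^{-β(t)|v|²/2}`.
If `K_f + 4|S^{d-1}| J(β₀/2) R² (T + (2T/λ)^{1/2}) ≤ R` then `|Φ(u)(t)| ≤ R e^{-β(t)|v|²/2}`.
[cite: GST2013, Part II Ch. 5 Thm 7] -/
theorem abs_picard_le
    {Qa : (EuclideanSpace ℝ d → ℝ) → EuclideanSpace ℝ d → ℝ}
    (hQa : ∀ p v, Qa p v = ∫ w, ∫ ω, hardSphereKernel (v, w) ω *
      (|p (collide ω (v, w)).1| * |p (collide ω (v, w)).2| - p v * |p w|) ∂sphereMeasure)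
    {T β₀ lam R Kf : ℝ} (hT : 0 < T) (hβ₀ : 0 < β₀) (hlam : lam = β₀ / (2 * T)) (hR : 0 ≤ R)
    {f₀ : UnitAddTorus d → EuclideanSpace ℝ d → ℝ}
    (hf₀b : ∀ y v, |f₀ y v| ≤ Kf * exp (-(β₀ / 2) * ‖v‖ ^ 2))
    {u : ℝ → UnitAddTorus d → EuclideanSpace ℝ d → ℝ}
    (hu : Continuous fun z : ℝ × UnitAddTorus d × EuclideanSpace ℝ d => u z.1 z.2.1 z.2.2)
    (hub : ∀ t y v, |u t y v| ≤ R * exp (-((β₀ - lam * max 0 (min T t)) / 2) * ‖v‖ ^ 2))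
    (hsmall : Kf + 4 * (sphereMeasure : Measure (sphere (0 : EuclideanSpace ℝ d) 1)).real univ *
        (∫ x : EuclideanSpace ℝ d, (1 + ‖x‖) * exp (-(β₀ / 2 / 2) * ‖x‖ ^ 2)) * R * R *
        (T + Real.sqrt (2 * T / lam)) ≤ R)
    (t : ℝ) (y : UnitAddTorus d) (v : EuclideanSpace ℝ d) :
    |f₀ (y - Literature.Analysis.FunctionSpaces.Torus.proj (max 0 (min T t) • v)) v +
        ∫ τ in (0 : ℝ)..max 0 (min T t),
          Qa (u τ (y - Literature.Analysis.FunctionSpaces.Torus.proj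
            ((max 0 (min T t) - τ) • v))) v| ≤
      R * exp (-((β₀ - lam * max 0 (min T t)) / 2) * ‖v‖ ^ 2) := by
  -- constants and the clamped time
  set S : ℝ := (sphereMeasure : Measure (sphere (0 : EuclideanSpace ℝ d) 1)).real univ with hS
  set J : ℝ := ∫ x : EuclideanSpace ℝ d, (1 + ‖x‖) * exp (-(β₀ / 2 / 2) * ‖x‖ ^ 2) with hJ
  have hS0 : 0 ≤ S := measureReal_nonneg
  have hJ0 : 0 ≤ J := integral_one_add_norm_mul_exp_nonneg (β₀ / 2)
  set t' : ℝ := max 0 (min T t) with ht'_def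
  have ht' : t' ∈ Icc 0 T := ⟨le_max_left _ _, max_le hT.le (min_le_left _ _)⟩
  have hlam0 : 0 < lam := by rw [hlam]; positivity
  have hlamT : lam * T = β₀ / 2 := by rw [hlam]; field_simp
  have hclamp : ∀ τ ∈ Icc 0 T, max 0 (min T τ) = τ := fun τ hτ => by
    rw [min_eq_right hτ.2, max_eq_right hτ.1]
  have hwlo : ∀ τ ∈ Icc 0 T, β₀ / 2 ≤ β₀ - lam * τ := fun τ hτ => by
    nlinarith [mul_le_mul_of_nonneg_left hτ.2 hlam0.le]
  have hwhi : ∀ τ ∈ Icc 0 T, β₀ - lam * τ ≤ β₀ := fun τ hτ => by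
    nlinarith [mul_nonneg hlam0.le hτ.1]
  -- `Kf ≥ 0` and the datum at the weight `β(t') ≤ β₀`
  have hε0 : 0 ≤ T + Real.sqrt (2 * T / lam) := by positivity
  have hKf : 0 ≤ Kf := by
    have h := (abs_nonneg _).trans (hf₀b y v)
    exact nonneg_of_mul_nonneg_left (by linarith [h]) (exp_pos (-(β₀ / 2) * ‖v‖ ^ 2))
  have h1 : |f₀ (y - Literature.Analysis.FunctionSpaces.Torus.proj (t' • v)) v| ≤
      Kf * exp (-((β₀ - lam * t') / 2) * ‖v‖ ^ 2) := by
    refine (hf₀b _ v).trans (mul_le_mul_of_nonneg_left (exp_le_exp.2 ?_) hKf)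
    nlinarith [sq_nonneg ‖v‖, hwhi t' ht']
  -- the global weaker bound on `u`, for the continuity lemma
  have hub' : ∀ s z w, |u s z w| ≤ R * exp (-(β₀ / 2 / 2) * ‖w‖ ^ 2) := by
    intro s z w
    refine (hub s z w).trans (mul_le_mul_of_nonneg_left (exp_le_exp.2 ?_) hR)
    have := hwlo (max 0 (min T s)) ⟨le_max_left _ _, max_le hT.le (min_le_left _ _)⟩
    nlinarith [sq_nonneg ‖w‖]
  have hF := continuous_absCollision_slice hQa hu (by positivity : 0 < β₀ / 2) hub'
  -- the collision term along the characteristic and its bound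
  set b : ℝ → ℝ := fun τ => 4 * 1 * S * J * R * R *
    ((1 + ‖v‖) * exp (-((β₀ - lam * τ) / 2) * ‖v‖ ^ 2)) with hb_def
  have hb_cont : Continuous b := by
    simp only [hb_def]
    fun_prop
  have hbound : ∀ τ ∈ Ioc 0 t',
      ‖Qa (u τ (y - Literature.Analysis.FunctionSpaces.Torus.proj ((t' - τ) • v))) v‖ ≤ b τ := by
    intro τ hτ
    have hτT : τ ∈ Icc 0 T := ⟨hτ.1.le, hτ.2.trans ht'.2⟩
    set y' : UnitAddTorus d := y - Literature.Analysis.FunctionSpaces.Torus.proj ((t' - τ) • v)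
      with hy'
    have hpm : Measurable (u τ y') :=
      (hu.comp (continuous_const.prodMk (continuous_const.prodMk continuous_id))).measurable
    have hp : ∀ w, |u τ y' w| ≤ R * exp (-((β₀ - lam * τ) / 2) * ‖w‖ ^ 2) := fun w => by
      have h := hub τ y' w
      rwa [hclamp τ hτT] at h
    have hL := (collisionOpWith_bound_gaussian (isGradCutoffKernel_hardSphereKernel)
      zero_le_one hardSphereKernel_le_one_mul (by positivity : 0 < β₀ / 2) (hwlo τ hτT) hpm hR
      hp v).2
    rw [Real.norm_eq_abs, hQa]
    exact hL
  have h2 : |∫ τ in (0 : ℝ)..t',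
      Qa (u τ (y - Literature.Analysis.FunctionSpaces.Torus.proj ((t' - τ) • v))) v| ≤
      4 * S * J * R * R * (T + Real.sqrt (2 * T / lam)) *
        exp (-((β₀ - lam * t') / 2) * ‖v‖ ^ 2) := by
    rw [← Real.norm_eq_abs]
    refine (intervalIntegral.norm_integral_le_of_norm_le ht'.1 (Eventually.of_forall hbound)
      (hb_cont.intervalIntegrable _ _)).trans ?_
    simp only [hb_def]
    rw [intervalIntegral.integral_const_mul]
    have hC0 : 0 ≤ 4 * 1 * S * J * R * R := by positivity
    calc 4 * 1 * S * J * R * R * ∫ τ in (0 : ℝ)..t', (1 + ‖v‖) * exp (-((β₀ - lam * τ) / 2) * ‖v‖ ^ 2)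
        ≤ 4 * 1 * S * J * R * R * ((T + Real.sqrt (2 * T / lam)) *
            exp (-((β₀ - lam * t') / 2) * ‖v‖ ^ 2)) :=
          mul_le_mul_of_nonneg_left (weight_integral_clamp_le hlam0 ht' ‖v‖) hC0
      _ = 4 * S * J * R * R * (T + Real.sqrt (2 * T / lam)) *
            exp (-((β₀ - lam * t') / 2) * ‖v‖ ^ 2) := by ring
  -- conclusion
  calc |f₀ (y - Literature.Analysis.FunctionSpaces.Torus.proj (t' • v)) v +
        ∫ τ in (0 : ℝ)..t',
          Qa (u τ (y - Literature.Analysis.FunctionSpaces.Torus.proj ((t' - τ) • v))) v|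
      ≤ |f₀ (y - Literature.Analysis.FunctionSpaces.Torus.proj (t' • v)) v| +
          |∫ τ in (0 : ℝ)..t',
            Qa (u τ (y - Literature.Analysis.FunctionSpaces.Torus.proj ((t' - τ) • v))) v| :=
        abs_add_le _ _
    _ ≤ Kf * exp (-((β₀ - lam * t') / 2) * ‖v‖ ^ 2) +
          4 * S * J * R * R * (T + Real.sqrt (2 * T / lam)) *
            exp (-((β₀ - lam * t') / 2) * ‖v‖ ^ 2) := add_le_add h1 h2
    _ = (Kf + 4 * S * J * R * R * (T + Real.sqrt (2 * T / lam))) *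
          exp (-((β₀ - lam * t') / 2) * ‖v‖ ^ 2) := by ring
    _ ≤ R * exp (-((β₀ - lam * t') / 2) * ‖v‖ ^ 2) :=
        mul_le_mul_of_nonneg_right hsmall (exp_pos _).le

/-- **Lipschitz estimate for the Picard map on the weighted ball** (the contraction of GST 2013
Part II Ch. 5, proof of Thm 6–7, for the equation): with `T, λ, β(t)` as in `abs_picard_le`,
if `u, ũ` are jointly continuous, both bounded by `R e^{-β(t)|v|²/2}` and
`|u - ũ| ≤ D e^{-β(t)|v|²/2}`, then
`|Φ(u) - Φ(ũ)| ≤ 4|S^{d-1}| J(β₀/2) R (T + (2T/λ)^{1/2}) · D e^{-β(t)|v|²/2}`.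
[cite: GST2013, Part II Ch. 5 Thm 7] -/
theorem abs_picard_sub_picard_le
    {Qa : (EuclideanSpace ℝ d → ℝ) → EuclideanSpace ℝ d → ℝ}
    (hQa : ∀ p v, Qa p v = ∫ w, ∫ ω, hardSphereKernel (v, w) ω *
      (|p (collide ω (v, w)).1| * |p (collide ω (v, w)).2| - p v * |p w|) ∂sphereMeasure)
    {T β₀ lam R D : ℝ} (hT : 0 < T) (hβ₀ : 0 < β₀) (hlam : lam = β₀ / (2 * T)) (hR : 0 ≤ R)
    (hD : 0 ≤ D) (f₀ : UnitAddTorus d → EuclideanSpace ℝ d → ℝ)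
    {u w : ℝ → UnitAddTorus d → EuclideanSpace ℝ d → ℝ}
    (hu : Continuous fun z : ℝ × UnitAddTorus d × EuclideanSpace ℝ d => u z.1 z.2.1 z.2.2)
    (hw : Continuous fun z : ℝ × UnitAddTorus d × EuclideanSpace ℝ d => w z.1 z.2.1 z.2.2)
    (hub : ∀ t y v, |u t y v| ≤ R * exp (-((β₀ - lam * max 0 (min T t)) / 2) * ‖v‖ ^ 2))
    (hwb : ∀ t y v, |w t y v| ≤ R * exp (-((β₀ - lam * max 0 (min T t)) / 2) * ‖v‖ ^ 2))
    (huw : ∀ t y v, |u t y v - w t y v| ≤ D * exp (-((β₀ - lam * max 0 (min T t)) / 2) * ‖v‖ ^ 2))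
    (t : ℝ) (y : UnitAddTorus d) (v : EuclideanSpace ℝ d) :
    |(f₀ (y - Literature.Analysis.FunctionSpaces.Torus.proj (max 0 (min T t) • v)) v +
        ∫ τ in (0 : ℝ)..max 0 (min T t),
          Qa (u τ (y - Literature.Analysis.FunctionSpaces.Torus.proj
            ((max 0 (min T t) - τ) • v))) v) -
      (f₀ (y - Literature.Analysis.FunctionSpaces.Torus.proj (max 0 (min T t) • v)) v +
        ∫ τ in (0 : ℝ)..max 0 (min T t),
          Qa (w τ (y - Literature.Analysis.FunctionSpaces.Torus.proj
            ((max 0 (min T t) - τ) • v))) v)| ≤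
      4 * (sphereMeasure : Measure (sphere (0 : EuclideanSpace ℝ d) 1)).real univ *
        (∫ x : EuclideanSpace ℝ d, (1 + ‖x‖) * exp (-(β₀ / 2 / 2) * ‖x‖ ^ 2)) * R *
        (T + Real.sqrt (2 * T / lam)) * D *
        exp (-((β₀ - lam * max 0 (min T t)) / 2) * ‖v‖ ^ 2) := by
  -- constants and the clamped time
  set S : ℝ := (sphereMeasure : Measure (sphere (0 : EuclideanSpace ℝ d) 1)).real univ with hS
  set J : ℝ := ∫ x : EuclideanSpace ℝ d, (1 + ‖x‖) * exp (-(β₀ / 2 / 2) * ‖x‖ ^ 2) with hJ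
  have hS0 : 0 ≤ S := measureReal_nonneg
  have hJ0 : 0 ≤ J := integral_one_add_norm_mul_exp_nonneg (β₀ / 2)
  set t' : ℝ := max 0 (min T t) with ht'_def
  have ht' : t' ∈ Icc 0 T := ⟨le_max_left _ _, max_le hT.le (min_le_left _ _)⟩
  have hlam0 : 0 < lam := by rw [hlam]; positivity
  have hclamp : ∀ τ ∈ Icc 0 T, max 0 (min T τ) = τ := fun τ hτ => by
    rw [min_eq_right hτ.2, max_eq_right hτ.1]
  have hwlo : ∀ τ ∈ Icc 0 T, β₀ / 2 ≤ β₀ - lam * τ := fun τ hτ => by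
    have hlamT : lam * T = β₀ / 2 := by rw [hlam]; field_simp
    nlinarith [mul_le_mul_of_nonneg_left hτ.2 hlam0.le]
  -- the global weaker bounds, for the continuity lemma
  have hweak : ∀ {g : ℝ → UnitAddTorus d → EuclideanSpace ℝ d → ℝ},
      (∀ t y v, |g t y v| ≤ R * exp (-((β₀ - lam * max 0 (min T t)) / 2) * ‖v‖ ^ 2)) →
      ∀ s z x, |g s z x| ≤ R * exp (-(β₀ / 2 / 2) * ‖x‖ ^ 2) := by
    intro g hg s z x
    refine (hg s z x).trans (mul_le_mul_of_nonneg_left (exp_le_exp.2 ?_) hR)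
    have := hwlo (max 0 (min T s)) ⟨le_max_left _ _, max_le hT.le (min_le_left _ _)⟩
    nlinarith [sq_nonneg ‖x‖]
  have hFu := continuous_absCollision_slice hQa hu (by positivity : 0 < β₀ / 2) (hweak hub)
  have hFw := continuous_absCollision_slice hQa hw (by positivity : 0 < β₀ / 2) (hweak hwb)
  -- interval integrability of the two collision terms along the characteristic
  have hπ := Literature.Analysis.FunctionSpaces.Torus.continuous_proj (d := d)
  have hchar : Continuous fun τ : ℝ =>
      ((τ, y - Literature.Analysis.FunctionSpaces.Torus.proj ((t' - τ) • v), v) :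
        ℝ × UnitAddTorus d × EuclideanSpace ℝ d) := by fun_prop
  have hIu : IntervalIntegrable (fun τ =>
      Qa (u τ (y - Literature.Analysis.FunctionSpaces.Torus.proj ((t' - τ) • v))) v) volume 0 t' :=
    (hFu.comp hchar).intervalIntegrable _ _
  have hIw : IntervalIntegrable (fun τ =>
      Qa (w τ (y - Literature.Analysis.FunctionSpaces.Torus.proj ((t' - τ) • v))) v) volume 0 t' :=
    (hFw.comp hchar).intervalIntegrable _ _
  -- the pointwise Lipschitz bound on the integrand
  set b : ℝ → ℝ := fun τ => 4 * 1 * S * J * R * D *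
    ((1 + ‖v‖) * exp (-((β₀ - lam * τ) / 2) * ‖v‖ ^ 2)) with hb_def
  have hb_cont : Continuous b := by
    simp only [hb_def]
    fun_prop
  have hbound : ∀ τ ∈ Ioc 0 t',
      ‖Qa (u τ (y - Literature.Analysis.FunctionSpaces.Torus.proj ((t' - τ) • v))) v -
        Qa (w τ (y - Literature.Analysis.FunctionSpaces.Torus.proj ((t' - τ) • v))) v‖ ≤ b τ := by
    intro τ hτ
    have hτT : τ ∈ Icc 0 T := ⟨hτ.1.le, hτ.2.trans ht'.2⟩
    set y' : UnitAddTorus d := y - Literature.Analysis.FunctionSpaces.Torus.proj ((t' - τ) • v)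
      with hy'
    have hpm : Measurable (u τ y') :=
      (hu.comp (continuous_const.prodMk (continuous_const.prodMk continuous_id))).measurable
    have hqm : Measurable (w τ y') :=
      (hw.comp (continuous_const.prodMk (continuous_const.prodMk continuous_id))).measurable
    have hp : ∀ x, |u τ y' x| ≤ R * exp (-((β₀ - lam * τ) / 2) * ‖x‖ ^ 2) := fun x => by
      have h := hub τ y' x
      rwa [hclamp τ hτT] at h
    have hq : ∀ x, |w τ y' x| ≤ R * exp (-((β₀ - lam * τ) / 2) * ‖x‖ ^ 2) := fun x => by
      have h := hwb τ y' x
      rwa [hclamp τ hτT] at h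
    have hpq : ∀ x, |u τ y' x - w τ y' x| ≤ D * exp (-((β₀ - lam * τ) / 2) * ‖x‖ ^ 2) :=
      fun x => by
      have h := huw τ y' x
      rwa [hclamp τ hτT] at h
    have hL := (collisionOpWith_lipschitz_gaussian (isGradCutoffKernel_hardSphereKernel)
      zero_le_one hardSphereKernel_le_one_mul (by positivity : 0 < β₀ / 2) (hwlo τ hτT) hpm hqm
      hR hD hp hq hpq v).2
    rw [Real.norm_eq_abs, hQa, hQa]
    exact hL
  -- integrate
  rw [add_sub_add_left_eq_sub, ← intervalIntegral.integral_sub hIu hIw, ← Real.norm_eq_abs]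
  refine (intervalIntegral.norm_integral_le_of_norm_le ht'.1 (Eventually.of_forall hbound)
    (hb_cont.intervalIntegrable _ _)).trans ?_
  simp only [hb_def]
  rw [intervalIntegral.integral_const_mul]
  have hC0 : 0 ≤ 4 * 1 * S * J * R * D := by positivity
  calc 4 * 1 * S * J * R * D * ∫ τ in (0 : ℝ)..t', (1 + ‖v‖) * exp (-((β₀ - lam * τ) / 2) * ‖v‖ ^ 2)
      ≤ 4 * 1 * S * J * R * D * ((T + Real.sqrt (2 * T / lam)) *
          exp (-((β₀ - lam * t') / 2) * ‖v‖ ^ 2)) :=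
        mul_le_mul_of_nonneg_left (weight_integral_clamp_le hlam0 ht' ‖v‖) hC0
    _ = 4 * S * J * R * (T + Real.sqrt (2 * T / lam)) * D *
          exp (-((β₀ - lam * t') / 2) * ‖v‖ ^ 2) := by ring

end Picard

end

end Literature.MathematicalPhysics.KineticTheory
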